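import Mathlib
import HarnessLib
import Summits.MatrixMultiplication.Statement
import Summits.MatrixMultiplication.MatrixMultiplication.Theses.FarEdgeDescent
import Literature.Computability.AlgebraicComplexity.RectangularExponentAsymptoticRank
import Literature.Computability.AlgebraicComplexity.RectangularExponentInformationBound
import Literature.Computability.AlgebraicComplexity.AsymptoticSpectrumDuality
import Literature.Computability.AlgebraicComplexity.DegenerationSpectralMonotone
import Literature.Computability.AlgebraicComplexity.TensorRestrictionRank
import Literature.Computability.AlgebraicComplexity.BorderRankCW

/-!
# FarEdgeDescent — the MM-cheapness gate (lens 2, gen 9): when is an explicit-host flatness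
piece NECESSARY for `ω = 2`?

Route `route-MatrixMultiplication-FarEdgeDescent`, supports the aside
`stmt-MatrixMultiplication-30671` (`Theses.FarEdgeDescent.LittleCwFlat`:
`∃ k ≥ 2, R̃(cw_{k+1}) ≤ k + 2`).  The aside is an `ω`-free SUFFICIENT condition for the cone crux
`FiniteSaturation` (transfer `Theorems.FarEdgeDescentLittleCwTransfer`).  This file records, kernel
checked, the criterion deciding whether such a single-tensor flatness statement is also NECESSARY
(implied by `ω = 2`), i.e. whether replacing `FiniteSaturation` by it would keep the route's cut
exact:

* an **MM-cost certificate at level `F`** for a tensor `t` (spelled out as a hypothesis, no new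
  `Prop` constant): for every `ε > 0` some Kronecker power `t^{⊠(N+1)}` is an (algebraic, BCS
  (15.19): polynomial-matrix, kernel-checkable) DEGENERATION of a matrix multiplication tensor
  `⟨q^a, q^b, q^c⟩` (`q ≥ 2`) whose flat cost `q^{a+b+c-min(a,b,c)}` is at most `(F + ε)^{N+1}` —
  "the asymptotic MM-degeneration cost of `t` is at most `F`" (restrictions are order-0
  degenerations, `TensorRestrictsTo.algDegeneratesTo`).
* `asymptoticRank_le_of_restrictsTo` / `asymptoticRank_le_of_algDegeneratesTo` — `R̃` is monotone
  under restriction and under degeneration (Strassen duality + the tree's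
  `IsUniversalSpectralPoint.mono_of_algDegeneratesTo`).
* `asymptoticRank_le_of_mmCheapAt` — **under `ω = 2`, every `t` with an MM-cost certificate at `F`
  has `R̃(t) ≤ F`** (`R̃(t)^{N+1} = Φ(t^{⊠(N+1)}) ≤ R̃⟨q^a,q^b,q^c⟩ = q^{ω(a,b,c)} = q^{a+b+c-min}`
  for a spectral point `Φ` attaining `R̃(t)`; Huang–Pan information identity under `ω = 2`).
* `mmCheapAt_matMulTensor` — matrix multiplication tensors carry the certificate at their flat cost;
  hence `arcOnMMCheap_iff`: **"asymptotic rank ≤ certified MM-cost for every certified tensor" is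
  EQUIVALENT to `ω = 2`** (an EQUIV frame: as a node piece it is summit-strength; stated inline, no
  new `Prop` constant).
* `mm_imp_littleCwFlat_of_mmCheapAt` — **the gate**: an MM-cost certificate for one little
  Coppersmith–Winograd tensor `cw_{k+1}` at its flattening value `k + 2` makes `LittleCwFlat` a
  consequence of `ω = 2` (NEC).  No such certificate is known: `bR(cw_q) = q + 2` (CGLV 2022, §1.2)
  and the Kronecker square / cube keep border rank `(q+2)²` (`q > 2`) / `(q+2)³` (`q > 4`) (CGLV
  2022, Thm. 1.2), so flatness `R̃(cw_q) = q + 1` is open, and no MM-degeneration of a power of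
  `cw_q` at cost exponent `→ q + 1` is in print; a certificate through a unit tensor
  (`⟨q^a,q^b,q^c⟩ ⊵ ⟨r⟩ ⊵ cw_q^{⊠N}`) would already presuppose the rank bound.  The smallest
  same-format single-step candidate `⟨2,2,2⟩ ⊵ cw₃` is impossible by orbit dimension (`42 > 37`,
  NODE-v9 §3); the first undecided one is `⟨3,3,3⟩ ⊵ cw₈` (orbit dimensions `217 ≥ 212`).

No `sorry`; standard axioms.  Informal companion: `pub/decomp-mm/decomp-mm-lens-2/gen9/NODE-v9.md`.
-/

namespace Summit.MatrixMultiplication.MatrixMultiplication.Theorems.FarEdgeDescentMMCheap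

open Literature.Computability.AlgebraicComplexity
open Summit.MatrixMultiplication.MatrixMultiplication.Theses.FarEdgeDescent (LittleCwFlat)

set_option linter.dupNamespace false

noncomputable section

variable {ι κ μ : Type} [Fintype ι] [Fintype κ] [Fintype μ]

/-- `t ≥ t^{⊠1}`: a tensor restricts to its first Kronecker power (relabelling along
`ι ≅ (Fin 1 → ι)`; companion of the tree's `tensorRestrictsTo_kroneckerPow_one`, the other
direction). [folklore] -/
theorem tensorRestrictsTo_self_kroneckerPow_one {K : Type} [CommSemiring K] [DecidableEq ι]
    [DecidableEq κ] [DecidableEq μ] (t : ι → κ → μ → K) :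
    TensorRestrictsTo t (kroneckerPow t 1) := by
  have h := tensorRestrictsTo_precomp t (fun a : Fin 1 → ι => a 0) (fun b : Fin 1 → κ => b 0)
    (fun c : Fin 1 → μ => c 0)
  have e : kroneckerPow t 1 = fun a b c => t (a 0) (b 0) (c 0) := by
    funext a b c
    exact Fin.prod_univ_one (fun i => t (a i) (b i) (c i))
  rw [e]
  exact h

/-- **`R̃` is monotone under restriction**: `t ≥ s ⟹ R̃(s) ≤ R̃(t)` (take a universal spectral point
attaining `R̃(s)`; it is restriction-monotone and bounded by `R̃(t)` — Strassen duality, proved in the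
tree as `strassen_duality_asymptoticRank_holds`). [cite: ChristandlVranaZuiddam2023, Prop. 1.6] -/
theorem asymptoticRank_le_of_restrictsTo {K : Type} [Field K] {ι' κ' μ' : Type} [Fintype ι']
    [Fintype κ'] [Fintype μ'] {t : ι → κ → μ → K} {s : ι' → κ' → μ' → K}
    (h : TensorRestrictsTo t s) : asymptoticRank s ≤ asymptoticRank t := by
  obtain ⟨F, hF, hFs⟩ := (strassen_duality_asymptoticRank_holds K s).2
  rw [← hFs]
  exact (hF.mono t s h).trans ((strassen_duality_asymptoticRank_holds K t).1 F hF)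

omit [Fintype ι] [Fintype κ] [Fintype μ] in
/-- **`R̃` is monotone under degeneration**: `s ⊵ t ⟹ R̃(t) ≤ R̃(s)` (a universal spectral point
attaining `R̃(t)` is degeneration-monotone — the tree's `IsUniversalSpectralPoint.mono_of_algDegeneratesTo`
— and bounded by `R̃(s)`). [cite: Strassen1988, §3] -/
theorem asymptoticRank_le_of_algDegeneratesTo {K : Type} [Field K] {ι' κ' μ' : Type} [Fintype ι]
    [Fintype κ] [Fintype μ] [Fintype ι'] [Fintype κ'] [Fintype μ'] {s : ι → κ → μ → K}
    {t : ι' → κ' → μ' → K} (h : AlgDegeneratesTo s t) : asymptoticRank t ≤ asymptoticRank s := by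
  obtain ⟨F, hF, hFt⟩ := (strassen_duality_asymptoticRank_holds K t).2
  rw [← hFt]
  exact (hF.mono_of_algDegeneratesTo h).trans ((strassen_duality_asymptoticRank_holds K s).1 F hF)

/-- **Under `ω = 2`, an MM-cost certificate at `F ≥ 0` bounds the asymptotic rank: `R̃(t) ≤ F`.**
Chain, with `Φ` a universal spectral point attaining `R̃(t)` (Strassen duality):
`R̃(t)^{N+1} = Φ(t^{⊠(N+1)}) ≤ Φ⟨q^a,q^b,q^c⟩ ≤ R̃⟨q^a,q^b,q^c⟩ = q^{ω(a,b,c)} = q^{a+b+c-min(a,b,c)}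
≤ (F+ε)^{N+1}` for every `ε > 0` (`Φ` is degeneration-monotone). [this route; ingredients: ChristandlVranaZuiddam2023 Prop. 1.6,
AlmanDuanVassilevskaWilliamsXuXuZhou2025 §3.4, HuangPan1998 §2] -/
theorem asymptoticRank_le_of_mmCheapAt (hS : _root_.MatrixMultiplication) {t : ι → κ → μ → ℂ}
    {F : ℝ} (hF : 0 ≤ F)
    (h : (∀ ε : ℝ, 0 < ε → ∃ N q a b c : ℕ, 2 ≤ q ∧
      AlgDegeneratesTo (matMulTensor ℂ (q ^ a) (q ^ b) (q ^ c)) (kroneckerPow t (N + 1)) ∧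
      (q : ℝ) ^ ((a : ℝ) + b + c - min (a : ℝ) (min (b : ℝ) (c : ℝ))) ≤ (F + ε) ^ (N + 1))) :
    asymptoticRank t ≤ F := by
  have hω : omega ℂ = 2 := hS
  have hR0 : 0 ≤ asymptoticRank t := asymptoticRank_nonneg t
  refine le_of_forall_pos_lt_add fun ε hε => ?_
  obtain ⟨N, q, a, b, c, hq, hres, hcost⟩ := h (ε / 2) (half_pos hε)
  -- a universal spectral point `Φ` attaining `R̃(t)` (Strassen duality):
  -- `R̃(t)^{N+1} = Φ(t)^{N+1} = Φ(t^{⊠(N+1)}) ≤ Φ⟨q^a,q^b,q^c⟩ ≤ R̃⟨q^a,q^b,q^c⟩ = q^{ω(a,b,c)}`.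
  obtain ⟨Φ, hΦ, hΦt⟩ := (strassen_duality_asymptoticRank_holds ℂ t).2
  have h1 : asymptoticRank t ^ (N + 1) ≤
      asymptoticRank (matMulTensor ℂ (q ^ a) (q ^ b) (q ^ c)) := by
    rw [← hΦt, ← hΦ.map_kroneckerPow t (N + 1)]
    exact (hΦ.mono_of_algDegeneratesTo hres).trans
      ((strassen_duality_asymptoticRank_holds ℂ _).1 Φ hΦ)
  have h3 : asymptoticRank (matMulTensor ℂ (q ^ a) (q ^ b) (q ^ c)) =
      (q : ℝ) ^ omegaRect ℂ a b c :=
    asymptoticRank_matMulTensor_rect ℂ hq a b c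
  have h4 : omegaRect ℂ a b c = (a : ℝ) + b + c - min (a : ℝ) (min (b : ℝ) (c : ℝ)) :=
    omegaRect_eq_sub_min_of_omega_eq_two ℂ hω (Nat.cast_nonneg a) (Nat.cast_nonneg b)
      (Nat.cast_nonneg c)
  have hle : asymptoticRank t ^ (N + 1) ≤ (F + ε / 2) ^ (N + 1) :=
    calc asymptoticRank t ^ (N + 1)
        ≤ asymptoticRank (matMulTensor ℂ (q ^ a) (q ^ b) (q ^ c)) := h1
      _ = (q : ℝ) ^ omegaRect ℂ a b c := h3
      _ = (q : ℝ) ^ ((a : ℝ) + b + c - min (a : ℝ) (min (b : ℝ) (c : ℝ))) := by rw [h4]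
      _ ≤ (F + ε / 2) ^ (N + 1) := hcost
  have hFε : 0 ≤ F + ε / 2 := by linarith
  have hmain : asymptoticRank t ≤ F + ε / 2 :=
    le_of_pow_le_pow_left₀ (Nat.succ_ne_zero N) hFε hle
  linarith

/-- **Matrix multiplication tensors carry the certificate at their flat cost**:
`⟨q₀^{a₀},q₀^{b₀},q₀^{c₀}⟩` is certified at level `q₀^{a₀+b₀+c₀-min(a₀,b₀,c₀)}` (`N = 0`, `q = q₀`,
the order-0 degeneration `⟨·⟩ ≥ ⟨·⟩^{⊠1}`). [this route; folklore] -/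
theorem mmCheapAt_matMulTensor {q₀ : ℕ} (hq₀ : 2 ≤ q₀) (a₀ b₀ c₀ : ℕ) :
    (∀ ε : ℝ, 0 < ε → ∃ N q a b c : ℕ, 2 ≤ q ∧
      AlgDegeneratesTo (matMulTensor ℂ (q ^ a) (q ^ b) (q ^ c))
        (kroneckerPow (matMulTensor ℂ (q₀ ^ a₀) (q₀ ^ b₀) (q₀ ^ c₀)) (N + 1)) ∧
      (q : ℝ) ^ ((a : ℝ) + b + c - min (a : ℝ) (min (b : ℝ) (c : ℝ))) ≤
        ((q₀ : ℝ) ^ ((a₀ : ℝ) + b₀ + c₀ - min (a₀ : ℝ) (min (b₀ : ℝ) (c₀ : ℝ))) + ε) ^ (N + 1)) := by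
  intro ε hε
  refine ⟨0, q₀, a₀, b₀, c₀, hq₀, ?_, ?_⟩
  · simpa using
      (tensorRestrictsTo_self_kroneckerPow_one
        (matMulTensor ℂ (q₀ ^ a₀) (q₀ ^ b₀) (q₀ ^ c₀))).algDegeneratesTo
  · have h0 : 0 ≤ (q₀ : ℝ) ^ ((a₀ : ℝ) + b₀ + c₀ - min (a₀ : ℝ) (min (b₀ : ℝ) (c₀ : ℝ))) := by
      positivity
    simp only [zero_add, pow_one]
    linarith

/-- **EQUIV frame: "asymptotic rank ≤ certified MM-degeneration cost for every certified complex
tensor" `↔ ω = 2`.**  (`←` is `asymptoticRank_le_of_mmCheapAt`; `→`: apply the left side to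
`⟨2,2,2⟩ = ⟨2^1,2^1,2^1⟩`, certified at cost `2^2 = 4`, and use `R̃⟨2,2,2⟩ = 2^{ω(1,1,1)} = 2^ω`.)
As a node piece the left side is therefore summit-strength (costume); its value is as the criterion
behind `mm_imp_littleCwFlat_of_mmCheapAt`. [this route] -/
theorem arcOnMMCheap_iff :
    (∀ {ι κ μ : Type} [Fintype ι] [Fintype κ] [Fintype μ] (t : ι → κ → μ → ℂ) (F : ℝ),
      0 ≤ F →
      (∀ ε : ℝ, 0 < ε → ∃ N q a b c : ℕ, 2 ≤ q ∧
      AlgDegeneratesTo (matMulTensor ℂ (q ^ a) (q ^ b) (q ^ c)) (kroneckerPow t (N + 1)) ∧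
      (q : ℝ) ^ ((a : ℝ) + b + c - min (a : ℝ) (min (b : ℝ) (c : ℝ))) ≤ (F + ε) ^ (N + 1)) →
      asymptoticRank t ≤ F) ↔ _root_.MatrixMultiplication := by
  constructor
  · intro h
    have hcert := mmCheapAt_matMulTensor (le_refl 2) 1 1 1
    have hexp : ((1 : ℕ) : ℝ) + (1 : ℕ) + (1 : ℕ) - min ((1 : ℕ) : ℝ) (min ((1 : ℕ) : ℝ) ((1 : ℕ) : ℝ))
        = 2 := by norm_num
    rw [hexp] at hcert
    have hle := h (matMulTensor ℂ (2 ^ 1) (2 ^ 1) (2 ^ 1)) (((2 : ℕ) : ℝ) ^ (2 : ℝ))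
      (by positivity) hcert
    rw [asymptoticRank_matMulTensor_rect ℂ (le_refl 2) 1 1 1] at hle
    have hω : omegaRect ℂ 1 1 1 = omega ℂ := by
      have := omegaRect_one_one_one (K := ℂ)
      simpa using this
    have hcast : omegaRect ℂ ((1 : ℕ) : ℝ) ((1 : ℕ) : ℝ) ((1 : ℕ) : ℝ) = omegaRect ℂ 1 1 1 := by
      norm_num
    rw [hcast, hω] at hle
    have h2 : (1 : ℝ) < ((2 : ℕ) : ℝ) := by norm_num
    have hωle : omega ℂ ≤ 2 := (Real.rpow_le_rpow_left_iff h2).1 hle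
    have hωge : 2 ≤ omega ℂ := by
      have := two_le_omegaRect_one_one (K := ℂ) 1
      rw [hω] at this
      exact this
    show omega ℂ = 2
    exact le_antisymm hωle hωge
  · intro hS ι κ μ _ _ _ t F hF h
    classical
    exact asymptoticRank_le_of_mmCheapAt hS hF h

/-- **The gate (NEC direction for the aside `LittleCwFlat`).**  If some little Coppersmith–Winograd
tensor `cw_{k+1}` (`k ≥ 2`) carries an MM-cost certificate at its flattening value `k + 2`, then
`ω = 2` implies `LittleCwFlat` — so with such a certificate the recut
`S ⟺ LittleCwFlat ∧ AnchoredLogConvexity` would be exact (`LittleCwFlat → FiniteSaturation` is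
`Theorems.FarEdgeDescentLittleCwTransfer`).  No certificate is known; see the module docstring.
[this route] -/
theorem mm_imp_littleCwFlat_of_mmCheapAt {k : ℕ} (hk : 2 ≤ k)
    (h : (∀ ε : ℝ, 0 < ε → ∃ N q a b c : ℕ, 2 ≤ q ∧
      AlgDegeneratesTo (matMulTensor ℂ (q ^ a) (q ^ b) (q ^ c)) (kroneckerPow (cwTensor ℂ (k + 1)) (N + 1)) ∧
      (q : ℝ) ^ ((a : ℝ) + b + c - min (a : ℝ) (min (b : ℝ) (c : ℝ))) ≤ (((k : ℝ) + 2) + ε) ^ (N + 1))) :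
    _root_.MatrixMultiplication → LittleCwFlat := fun hS =>
  ⟨k, hk, asymptoticRank_le_of_mmCheapAt hS (by positivity) h⟩

end

end Summit.MatrixMultiplication.MatrixMultiplication.Theorems.FarEdgeDescentMMCheap
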